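import Mathlib
import Literature.Analysis.PDE.FarChannelsCutoffData
import Literature.Analysis.PDE.FarChannelsDuhamelStep
import Literature.Analysis.PDE.FarChannelsStepData
import Literature.Analysis.PDE.FarChannelsStepArith
import Literature.Analysis.PDE.Wave1DFarEnergyLimits
import Literature.Analysis.PDE.FarKernelSpanLemmas
import Literature.Analysis.Calculus.TwoVariablePartials
import HarnessLib

/-!
# Far-side channel estimate: the estimate at fixed cut-off size `θ`

Analysis/PDE support file (everything proved, no definitions). The step of the far channel estimate
that is iterated by the assembly: for a global `C²` function `φ` whose `V`-residual vanishes on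
`{x > ½}` and whose `V`-energy on `(ρ,∞)` at `t = 0` is finite, and for every `θ > 0`, there are
coefficients `(a,b)` such that the `V`-energy of the data of `φ − Q_{a,b}` on `(ρ,∞)`
(`Q_{a,b}` the true kernel element with these coefficients) is at most

  `ofReal(C₁ θ) + ofReal C₂ · (Λ⁺ + Λ⁻) + ofReal(C₃ D_r / ρ)`,

`Λ±` the two far channel energies of `φ` (`liminf` of lower Lebesgue integrals), `D_r` the initial
energy, with `C₁ = 3 + 96 C_A(1+K_f)`, `C₂ = 24 C_A(1+K_f)`, `C₃ = C_c(1536 C_A(1+K_f)A² + 12 K_f)`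
(`farStep`). Ingredients: cut-off data (`FarChannelsCutoffData`), the exact channel inequality for
the cut-off data (hypothesis `hA2`, from `InverseSquareExactChannelBound`), the Duhamel comparison
(`FarChannelsDuhamelStep`), the data-side inequality (`FarChannelsStepData`), the transfer
inequality (hypothesis `hKf`, from `FarChannelsTrueSpanTransfer`) and the bookkeeping
(`FarChannelsStepArith`). Route PhotonSphereChannels, `FixedModeChannels`, far side
(stmt-FinalStateConjecture-10048). Folklore.
-/

noncomputable section

namespace Literature.Analysis.PDE

open MeasureTheory Set Filter Topology Finset Literature.Analysis.Calculus

/-- The velocity slice `x ↦ ∂_tψ(t,x)` of a `C²` function is `C¹`. [folklore] -/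
theorem contDiff_one_tslice_deriv {ψ : ℝ → ℝ → ℝ} (hψ : ContDiff ℝ 2 (Function.uncurry ψ))
    (t : ℝ) : ContDiff ℝ 1 (fun x => deriv (fun τ => ψ τ x) t) := by
  obtain ⟨ψt, ψx, ψtt, ψtx, ψxx, -, -, -, hctx, -, h6, -, -, -, h10, -, -, -⟩ :=
    exists_partials_of_contDiff_two hψ
  have hfun : (fun x => deriv (fun τ => ψ τ x) t) = ψt t := funext fun x => (h6 t x).deriv
  rw [hfun, contDiff_one_iff_deriv]
  refine ⟨fun x => (h10 t x).differentiableAt, ?_⟩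
  have : deriv (ψt t) = ψtx t := funext fun x => (h10 t x).deriv
  rw [this]
  exact hctx.comp (continuous_const.prodMk continuous_id)

variable {V ι : ℝ → ℝ} {ℓ : ℕ} {E : ℕ → ℝ → ℝ} {A ρ Cc C_A Kf : ℝ}
  {Q : (ℕ → ℝ) → (ℕ → ℝ) → ℝ → ℝ → ℝ} {φ : ℝ → ℝ → ℝ}

set_option maxHeartbeats 400000 in
/-- **The far channel estimate at fixed cut-off size.** See the module docstring. [folklore] -/
theorem farStep (hV : Continuous V) (hV0 : ∀ x, 0 ≤ V x) (hι : ContDiff ℝ (⊤ : ℕ∞) ι)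
    (hιeq : ∀ x : ℝ, 1 / 2 ≤ x → ι x = x⁻¹) (hℓ : 1 ≤ ℓ) (hρ1 : 1 ≤ ρ)
    (hVA : ∀ x, ρ ≤ x → |V x - ℓ * (ℓ + 1) * ι x ^ 2| ≤ A * x ^ (-(5 / 2 : ℝ)))
    (hV2 : ∀ x, ρ ≤ x → (ℓ : ℝ) * (ℓ + 1) * ι x ^ 2 ≤ 2 * V x)
    (hV3 : ∀ x, ρ ≤ x → V x ≤ 2 * ((ℓ : ℝ) * (ℓ + 1) * ι x ^ 2))
    (hCc0 : 0 ≤ Cc)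
    (hCut : ∀ {f g : ℝ → ℝ}, ContDiff ℝ 2 f → ContDiff ℝ 1 g →
      IntegrableOn (fun x => g x ^ 2 + deriv f x ^ 2 + V x * f x ^ 2) (Ioi 1) →
      ∀ {θ : ℝ}, 0 < θ →
      ∃ (X : ℝ) (fX gX : ℝ → ℝ), ρ ≤ X ∧ ContDiff ℝ 2 fX ∧ ContDiff ℝ 1 gX ∧
        (∀ x, 2 * X ≤ x → fX x = 0) ∧ (∀ x, 2 * X ≤ x → gX x = 0) ∧
        IntegrableOn (fun x => (g x - gX x) ^ 2 + deriv (fun y => f y - fX y) x ^ 2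
          + V x * (f x - fX x) ^ 2) (Ioi ρ) ∧
        ∫ x in Ioi ρ, ((g x - gX x) ^ 2 + deriv (fun y => f y - fX y) x ^ 2
          + V x * (f x - fX x) ^ 2) ≤ θ ∧
        IntegrableOn (fun x => gX x ^ 2 + deriv fX x ^ 2 + V x * fX x ^ 2) (Ioi ρ) ∧
        ∫ x in Ioi ρ, (gX x ^ 2 + deriv fX x ^ 2 + V x * fX x ^ 2)
          ≤ Cc * ∫ x in Ioi ρ, (g x ^ 2 + deriv f x ^ 2 + V x * f x ^ 2))
    (hCA0 : 0 ≤ C_A)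
    (hA2 : ∀ (h g : ℝ → ℝ) (R B : ℝ), ContDiff ℝ 2 h → ContDiff ℝ 1 g → 1 ≤ R → R ≤ B →
      (∀ x, B ≤ x → h x = 0) → (∀ x, B ≤ x → g x = 0) →
      ∃ ψ₀ : ℝ → ℝ → ℝ, ContDiff ℝ 2 (Function.uncurry ψ₀) ∧
        (∀ t, ∀ x ∈ Ioi (1 / 2 : ℝ), iteratedDeriv 2 (fun τ => ψ₀ τ x) t
          = iteratedDeriv 2 (ψ₀ t) x - ℓ * (ℓ + 1) * ι x ^ 2 * ψ₀ t x) ∧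
        (∀ x, ψ₀ 0 x = h x) ∧ (∀ x, deriv (fun τ => ψ₀ τ x) 0 = g x) ∧
        ∃ Lp Lm : ℝ, 0 ≤ Lp ∧ 0 ≤ Lm ∧
          Tendsto (fun t => ∫ x in Ioi (R + t), (deriv (fun τ => ψ₀ τ x) t ^ 2 + deriv (ψ₀ t) x ^ 2 + (ℓ : ℝ) * (ℓ + 1) * ι x ^ 2 * ψ₀ t x ^ 2)) atTop (𝓝 Lp) ∧
          Tendsto (fun t => ∫ x in Ioi (R - t), (deriv (fun τ => ψ₀ τ x) t ^ 2 + deriv (ψ₀ t) x ^ 2 + (ℓ : ℝ) * (ℓ + 1) * ι x ^ 2 * ψ₀ t x ^ 2)) atBot (𝓝 Lm) ∧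
          ∃ α β : ℕ → ℝ, ∀ X, R ≤ X →
            ∫ x in R..X, (deriv (fun y => h y - ∑ k ∈ range (ℓ / 2 + 1), α k * ι y ^ (ℓ - 2 * k)) x ^ 2
              + (ℓ : ℝ) * (ℓ + 1) * ι x ^ 2
                * (h x - ∑ k ∈ range (ℓ / 2 + 1), α k * ι x ^ (ℓ - 2 * k)) ^ 2
              + (g x - ∑ k ∈ range ((ℓ + 1) / 2), β k * ι x ^ (ℓ - 2 * k)) ^ 2)
            ≤ C_A * (Lp + Lm))
    (hKf0 : 0 ≤ Kf)
    (hKf : ∀ (a b : ℕ → ℝ) (Q : ℝ → ℝ → ℝ),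
      (∀ y, Q 0 y
        = ∑ k ∈ range (ℓ / 2 + 1), a k / (∏ i ∈ range ℓ, (((2 * k : ℕ) : ℝ) - 2 * i - 1)) * E (2 * k) y
          + ∑ k ∈ range ((ℓ + 1) / 2), b k / (((2 * k + 1 : ℕ) : ℝ)
              * ∏ i ∈ range ℓ, (((2 * k : ℕ) : ℝ) - 2 * i - 1)) * E (2 * k + 1) y) →
      (∀ z, deriv (fun τ => Q τ z) 0
        = ∑ k ∈ range (ℓ / 2 + 1), a k / (∏ i ∈ range ℓ, (((2 * k : ℕ) : ℝ) - 2 * i - 1))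
              * ((2 * k : ℕ) : ℝ) * E (2 * k - 1) z
          + ∑ k ∈ range ((ℓ + 1) / 2), b k / (((2 * k + 1 : ℕ) : ℝ)
              * ∏ i ∈ range ℓ, (((2 * k : ℕ) : ℝ) - 2 * i - 1)) * (((2 * k + 1 : ℕ) : ℝ) * E (2 * k) z)) →
      IntegrableOn (fun x => ((∑ k ∈ range ((ℓ + 1) / 2), b k * ι x ^ (ℓ - 2 * k)) ^ 2
        + deriv (fun y => ∑ k ∈ range (ℓ / 2 + 1), a k * ι y ^ (ℓ - 2 * k)) x ^ 2 + ℓ * (ℓ + 1) * ι x ^ 2 * (∑ k ∈ range (ℓ / 2 + 1), a k * ι x ^ (ℓ - 2 * k)) ^ 2)) (Ioi ρ) →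
      IntegrableOn (fun x =>
        ((deriv (fun τ => Q τ x) 0 - ∑ k ∈ range ((ℓ + 1) / 2), b k * ι x ^ (ℓ - 2 * k)) ^ 2
        + deriv (fun y => Q 0 y - ∑ k ∈ range (ℓ / 2 + 1), a k * ι y ^ (ℓ - 2 * k)) x ^ 2 + V x * (Q 0 x - ∑ k ∈ range (ℓ / 2 + 1), a k * ι x ^ (ℓ - 2 * k)) ^ 2)) (Ioi ρ) ∧
      ∫ x in Ioi ρ, ((deriv (fun τ => Q τ x) 0 - ∑ k ∈ range ((ℓ + 1) / 2), b k * ι x ^ (ℓ - 2 * k)) ^ 2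
        + deriv (fun y => Q 0 y - ∑ k ∈ range (ℓ / 2 + 1), a k * ι y ^ (ℓ - 2 * k)) x ^ 2 + V x * (Q 0 x - ∑ k ∈ range (ℓ / 2 + 1), a k * ι x ^ (ℓ - 2 * k)) ^ 2)
      ≤ Kf / ρ * ∫ x in Ioi ρ, ((∑ k ∈ range ((ℓ + 1) / 2), b k * ι x ^ (ℓ - 2 * k)) ^ 2
        + deriv (fun y => ∑ k ∈ range (ℓ / 2 + 1), a k * ι y ^ (ℓ - 2 * k)) x ^ 2 + ℓ * (ℓ + 1) * ι x ^ 2 * (∑ k ∈ range (ℓ / 2 + 1), a k * ι x ^ (ℓ - 2 * k)) ^ 2))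
    (hQC : ∀ a b, ContDiff ℝ 2 (Function.uncurry (Q a b)))
    (hQ0 : ∀ (a b : ℕ → ℝ) y, Q a b 0 y
        = ∑ k ∈ range (ℓ / 2 + 1), a k / (∏ i ∈ range ℓ, (((2 * k : ℕ) : ℝ) - 2 * i - 1)) * E (2 * k) y
          + ∑ k ∈ range ((ℓ + 1) / 2), b k / (((2 * k + 1 : ℕ) : ℝ)
              * ∏ i ∈ range ℓ, (((2 * k : ℕ) : ℝ) - 2 * i - 1)) * E (2 * k + 1) y)
    (hQ1 : ∀ (a b : ℕ → ℝ) z, deriv (fun τ => Q a b τ z) 0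
        = ∑ k ∈ range (ℓ / 2 + 1), a k / (∏ i ∈ range ℓ, (((2 * k : ℕ) : ℝ) - 2 * i - 1))
              * ((2 * k : ℕ) : ℝ) * E (2 * k - 1) z
          + ∑ k ∈ range ((ℓ + 1) / 2), b k / (((2 * k + 1 : ℕ) : ℝ)
              * ∏ i ∈ range ℓ, (((2 * k : ℕ) : ℝ) - 2 * i - 1)) * (((2 * k + 1 : ℕ) : ℝ) * E (2 * k) z))
    (hφ : ContDiff ℝ 2 (Function.uncurry φ))
    (hφres : ∀ t x, 1 / 2 < x →
      iteratedDeriv 2 (fun τ => φ τ x) t - iteratedDeriv 2 (φ t) x + V x * φ t x = 0)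
    (hfinI : IntegrableOn (fun x => deriv (fun τ => φ τ x) 0 ^ 2 + deriv (φ 0) x ^ 2 + V x * φ 0 x ^ 2) (Ioi ρ))
    {θ : ℝ} (hθ : 0 < θ) :
    ∃ a b : ℕ → ℝ,
      ∫⁻ x in Ioi ρ, ENNReal.ofReal (deriv (fun τ => φ τ x - Q a b τ x) 0 ^ 2
          + deriv (fun y => φ 0 y - Q a b 0 y) x ^ 2 + V x * (φ 0 x - Q a b 0 x) ^ 2)
        ≤ ENNReal.ofReal ((3 + 96 * C_A * (1 + Kf)) * θ)
          + ENNReal.ofReal (24 * C_A * (1 + Kf))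
            * (liminf (fun t => ∫⁻ x in Ioi (ρ + |t|), ENNReal.ofReal (deriv (fun τ => φ τ x) t ^ 2 + deriv (φ t) x ^ 2 + V x * φ t x ^ 2)) atTop
              + liminf (fun t => ∫⁻ x in Ioi (ρ + |t|), ENNReal.ofReal (deriv (fun τ => φ τ x) t ^ 2 + deriv (φ t) x ^ 2 + V x * φ t x ^ 2)) atBot)
          + ENNReal.ofReal (Cc * (1536 * C_A * (1 + Kf) * A ^ 2 + 12 * Kf)
            * (∫ x in Ioi ρ, (deriv (fun τ => φ τ x) 0 ^ 2 + deriv (φ 0) x ^ 2 + V x * φ 0 x ^ 2)) / ρ) := by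
  have hρ0 : 0 < ρ := by linarith
  have hn2 : (2 : ℝ) ≤ ℓ * (ℓ + 1) := by
    have : (1 : ℝ) ≤ ℓ := by exact_mod_cast hℓ
    nlinarith
  -- the data of `φ`
  set f : ℝ → ℝ := φ 0 with hf_def
  set g : ℝ → ℝ := fun x => deriv (fun τ => φ τ x) 0 with hg_def
  have hfC : ContDiff ℝ 2 f := hφ.comp (contDiff_const.prodMk contDiff_id)
  have hgC : ContDiff ℝ 1 g := contDiff_one_tslice_deriv hφ 0
  -- the initial energy, as a real number
  set Dr : ℝ := ∫ x in Ioi ρ, (deriv (fun τ => φ τ x) 0 ^ 2 + deriv (φ 0) x ^ 2 + V x * φ 0 x ^ 2) with hDr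
  have hDr0 : 0 ≤ Dr := setIntegral_nonneg measurableSet_Ioi fun x _ =>
    wave1D_energyDensity_nonneg hV0 0 x
  -- integrability on `(1, ∞)`
  have hdens_c : Continuous fun x => deriv (fun τ => φ τ x) 0 ^ 2 + deriv (φ 0) x ^ 2 + V x * φ 0 x ^ 2 :=
    (continuous_wave1D_energyDensity hV hφ).comp (continuous_const.prodMk continuous_id)
  have hfin1 : IntegrableOn (fun x => g x ^ 2 + deriv f x ^ 2 + V x * f x ^ 2) (Ioi 1) := by
    have h1 : IntegrableOn (fun x => deriv (fun τ => φ τ x) 0 ^ 2 + deriv (φ 0) x ^ 2 + V x * φ 0 x ^ 2) (Ioc 1 ρ) :=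
      (hdens_c.integrableOn_Icc).mono_set Ioc_subset_Icc_self
    have := h1.union hfinI
    rw [Ioc_union_Ioi_eq_Ioi hρ1] at this
    exact this
  have hVlow : ∀ x, ρ ≤ x → (x ^ 2)⁻¹ ≤ V x := by
    intro x hx
    have hx0 : 0 < x := by linarith
    have h := hV2 x hx
    rw [hιeq x (by linarith), inv_pow] at h
    have : 0 ≤ (x ^ 2)⁻¹ := by positivity
    nlinarith
  -- (1) cut-off data
  obtain ⟨X, fX, gX, hXρ, hfXC, hgXC, hfX0, hgX0, htail_i, htail, hcut_i, hcut⟩ :=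
    hCut hfC hgC hfin1 hθ
  have hX1 : 1 ≤ X := hρ1.trans hXρ
  -- (2) the exact solution with the cut-off data
  obtain ⟨ψ₀, hψ₀C, hψ₀res, hd0, hd1, Lp, Lm, hLp0, hLm0, hLp, hLm, a, b, hbound⟩ :=
    hA2 fX gX ρ (2 * X) hfXC hgXC hρ1 (by linarith) hfX0 hgX0
  refine ⟨a, b, ?_⟩
  -- (3) the exact energy of the cut-off data: `E₀ = 2 Cc Dr`
  have hcut' : (∫ x in Ioi ρ, (gX x ^ 2 + deriv fX x ^ 2 + V x * fX x ^ 2)) ≤ Cc * Dr := hcut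
  have heex_c : Continuous fun x => gX x ^ 2 + deriv fX x ^ 2 + (ℓ : ℝ) * (ℓ + 1) * ι x ^ 2 * fX x ^ 2 :=
    ((hgXC.continuous.pow 2).add ((hfXC.continuous_deriv (by norm_num)).pow 2)).add
      ((continuous_const.mul (hι.continuous.pow 2)).mul (hfXC.continuous.pow 2))
  have heex_pt : ∀ x ∈ Ioi ρ, gX x ^ 2 + deriv fX x ^ 2 + (ℓ : ℝ) * (ℓ + 1) * ι x ^ 2 * fX x ^ 2
      ≤ 2 * (gX x ^ 2 + deriv fX x ^ 2 + V x * fX x ^ 2) := by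
    intro x hx
    have h := mul_le_mul_of_nonneg_right (hV2 x (le_of_lt hx)) (sq_nonneg (fX x))
    linarith [h, sq_nonneg (gX x), sq_nonneg (deriv fX x)]
  have heex_i : IntegrableOn (fun x => gX x ^ 2 + deriv fX x ^ 2
      + (ℓ : ℝ) * (ℓ + 1) * ι x ^ 2 * fX x ^ 2) (Ioi ρ) :=
    Integrable.mono' (hcut_i.const_mul 2) heex_c.aestronglyMeasurable
      ((ae_restrict_iff' measurableSet_Ioi).2 (ae_of_all _ fun x hx => by
        rw [Real.norm_eq_abs, abs_of_nonneg (by positivity)]; exact heex_pt x hx))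
  have heex_le : ∫ x in Ioi ρ, (gX x ^ 2 + deriv fX x ^ 2 + (ℓ : ℝ) * (ℓ + 1) * ι x ^ 2 * fX x ^ 2)
      ≤ 2 * Cc * Dr := by
    calc ∫ x in Ioi ρ, (gX x ^ 2 + deriv fX x ^ 2 + (ℓ : ℝ) * (ℓ + 1) * ι x ^ 2 * fX x ^ 2)
        ≤ ∫ x in Ioi ρ, 2 * (gX x ^ 2 + deriv fX x ^ 2 + V x * fX x ^ 2) :=
          setIntegral_mono_on heex_i (hcut_i.const_mul 2) measurableSet_Ioi heex_pt
      _ = 2 * ∫ x in Ioi ρ, (gX x ^ 2 + deriv fX x ^ 2 + V x * fX x ^ 2) := integral_const_mul _ _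
      _ ≤ 2 * Cc * Dr := by nlinarith [hcut']
  -- the same facts written with the data of `ψ₀`
  have h0 : ψ₀ 0 = fX := funext hd0
  have hE₀fun : (fun x => deriv (fun τ => ψ₀ τ x) 0 ^ 2 + deriv (ψ₀ 0) x ^ 2 + (ℓ : ℝ) * (ℓ + 1) * ι x ^ 2 * ψ₀ 0 x ^ 2)
      = fun x => gX x ^ 2 + deriv fX x ^ 2 + (ℓ : ℝ) * (ℓ + 1) * ι x ^ 2 * fX x ^ 2 := by
    funext x; rw [hd1 x, h0]
  have hE₀' : IntegrableOn (fun x => deriv (fun τ => ψ₀ τ x) 0 ^ 2 + deriv (ψ₀ 0) x ^ 2 + (ℓ : ℝ) * (ℓ + 1) * ι x ^ 2 * ψ₀ 0 x ^ 2) (Ioi ρ) ∧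
      ∫ x in Ioi ρ, (deriv (fun τ => ψ₀ τ x) 0 ^ 2 + deriv (ψ₀ 0) x ^ 2 + (ℓ : ℝ) * (ℓ + 1) * ι x ^ 2 * ψ₀ 0 x ^ 2) ≤ 2 * Cc * Dr := by
    rw [hE₀fun]; exact ⟨heex_i, heex_le⟩
  -- (4) the tail, written with `φ − ψ₀`
  have hsl : ∀ (χ : ℝ → ℝ → ℝ), ContDiff ℝ 2 (Function.uncurry χ) → ∀ x,
      DifferentiableAt ℝ (fun τ => χ τ x) 0 := fun χ hχ x =>
    ((hχ.comp (contDiff_id.prodMk contDiff_const)).differentiable (by norm_num)) 0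
  have htailfun : (fun x => deriv (fun τ => φ τ x - ψ₀ τ x) 0 ^ 2
      + deriv (fun y => φ 0 y - ψ₀ 0 y) x ^ 2 + V x * (φ 0 x - ψ₀ 0 x) ^ 2)
      = fun x => (g x - gX x) ^ 2 + deriv (fun y => f y - fX y) x ^ 2 + V x * (f x - fX x) ^ 2 := by
    funext x
    show _ = (deriv (fun τ => φ τ x) 0 - gX x) ^ 2 + deriv (fun y => φ 0 y - fX y) x ^ 2
      + V x * (φ 0 x - fX x) ^ 2
    rw [deriv_fun_sub (hsl φ hφ x) (hsl ψ₀ hψ₀C x), hd1 x, h0]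
  have hθ' : IntegrableOn (fun x => deriv (fun τ => φ τ x - ψ₀ τ x) 0 ^ 2
      + deriv (fun y => φ 0 y - ψ₀ 0 y) x ^ 2 + V x * (φ 0 x - ψ₀ 0 x) ^ 2) (Ioi ρ) ∧
      ∫ x in Ioi ρ, (deriv (fun τ => φ τ x - ψ₀ τ x) 0 ^ 2
      + deriv (fun y => φ 0 y - ψ₀ 0 y) x ^ 2 + V x * (φ 0 x - ψ₀ 0 x) ^ 2) ≤ θ := by
    rw [htailfun]; exact ⟨htail_i, htail⟩
  -- (5) the Duhamel comparison
  have hduh := fun t => farComparison_duhamel hV hV0 hι hιeq hℓ hρ1 hVA hV2 hφ hφres hψ₀C hψ₀res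
    hθ' hE₀' t
  have hc : 2 * θ + 16 * A ^ 2 * (2 * Cc * Dr) / ρ = 2 * θ + 32 * A ^ 2 * Cc * Dr / ρ := by ring
  -- (6) integrability of the exact far energies of `ψ₀`
  set V₀ : ℝ → ℝ := fun x => (ℓ : ℝ) * (ℓ + 1) * ι x ^ 2 with hV₀
  have hV₀c : Continuous V₀ := continuous_const.mul (hι.continuous.pow 2)
  have hV₀0 : ∀ x, 0 ≤ V₀ x := fun x => by simp only [hV₀]; positivity
  set G : ℝ → ℝ → ℝ := fun t x =>
    iteratedDeriv 2 (fun τ => ψ₀ τ x) t - iteratedDeriv 2 (ψ₀ t) x + V₀ x * ψ₀ t x with hG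
  have hGc : Continuous (Function.uncurry G) := continuous_wave1D_residual hV₀c hψ₀C
  have hGsol : ∀ t x, iteratedDeriv 2 (fun τ => ψ₀ τ x) t - iteratedDeriv 2 (ψ₀ t) x
      + V₀ x * ψ₀ t x = G t x := fun t x => rfl
  have hG0 : ∀ τ x, ρ ≤ x → G τ x = 0 := by
    intro τ x hx
    have hx' : x ∈ Ioi (1 / 2 : ℝ) := by
      show (1 / 2 : ℝ) < x
      linarith
    simp only [hG, hV₀, hψ₀res τ x hx']; ring
  have hfin0 : ∫⁻ x in Ioi ρ, ENNReal.ofReal (deriv (fun τ => ψ₀ τ x) 0 ^ 2 + deriv (ψ₀ 0) x ^ 2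
      + V₀ x * ψ₀ 0 x ^ 2) < ⊤ := by
    rw [← ofReal_integral_eq_lintegral_ofReal hE₀'.1
      (ae_of_all _ fun x => wave1D_energyDensity_nonneg hV₀0 0 x)]
    exact ENNReal.ofReal_lt_top
  have hIint : ∀ t, IntegrableOn (fun x => deriv (fun τ => ψ₀ τ x) t ^ 2 + deriv (ψ₀ t) x ^ 2 + (ℓ : ℝ) * (ℓ + 1) * ι x ^ 2 * ψ₀ t x ^ 2) (Ioi (ρ + |t|)) := fun t =>
    (wave1D_farEnergy_integrableOn hV₀c hV₀0 hGc hψ₀C hGsol (c := ρ) hG0 hfin0 t).1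
  -- (7) the exact channel limits against the true channel energies
  have hevp : ∀ᶠ t in atTop, ENNReal.ofReal (∫ x in Ioi (ρ + t), (deriv (fun τ => ψ₀ τ x) t ^ 2 + deriv (ψ₀ t) x ^ 2 + (ℓ : ℝ) * (ℓ + 1) * ι x ^ 2 * ψ₀ t x ^ 2))
      ≤ 4 * (∫⁻ x in Ioi (ρ + |t|), ENNReal.ofReal (deriv (fun τ => φ τ x) t ^ 2 + deriv (φ t) x ^ 2 + V x * φ t x ^ 2))
        + 4 * ENNReal.ofReal (2 * θ + 32 * A ^ 2 * Cc * Dr / ρ) := by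
    filter_upwards [eventually_ge_atTop (0 : ℝ)] with t ht
    have e : ρ + t = ρ + |t| := by rw [abs_of_nonneg ht]
    rw [e, ofReal_integral_eq_lintegral_ofReal (hIint t)
      (ae_of_all _ fun x => wave1D_energyDensity_nonneg hV₀0 t x), ← hc]
    exact hduh t
  have hevm : ∀ᶠ t in atBot, ENNReal.ofReal (∫ x in Ioi (ρ - t), (deriv (fun τ => ψ₀ τ x) t ^ 2 + deriv (ψ₀ t) x ^ 2 + (ℓ : ℝ) * (ℓ + 1) * ι x ^ 2 * ψ₀ t x ^ 2))
      ≤ 4 * (∫⁻ x in Ioi (ρ + |t|), ENNReal.ofReal (deriv (fun τ => φ τ x) t ^ 2 + deriv (φ t) x ^ 2 + V x * φ t x ^ 2))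
        + 4 * ENNReal.ofReal (2 * θ + 32 * A ^ 2 * Cc * Dr / ρ) := by
    filter_upwards [eventually_le_atBot (0 : ℝ)] with t ht
    have e : ρ - t = ρ + |t| := by rw [abs_of_nonpos ht]; ring
    rw [e, ofReal_integral_eq_lintegral_ofReal (hIint t)
      (ae_of_all _ fun x => wave1D_energyDensity_nonneg hV₀0 t x), ← hc]
    exact hduh t
  have hp := ofReal_lim_le_liminf_affine hLp hevp
  have hm := ofReal_lim_le_liminf_affine hLm hevm
  -- (8) the data side
  set tpos : ℝ → ℝ := Q a b 0 with htpos_def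
  set tvel : ℝ → ℝ := fun z => deriv (fun τ => Q a b τ z) 0 with htvel_def
  have htposC : ContDiff ℝ 1 tpos :=
    ((hQC a b).comp (contDiff_const.prodMk contDiff_id)).of_le (by norm_num)
  have htvelC : Continuous tvel := (contDiff_one_tslice_deriv (hQC a b) 0).continuous
  have hdata := farStep_data (f := f) (g := g) (tpos := tpos) (tvel := tvel) (T := θ)
    (E₀ := 2 * Cc * Dr) (S := C_A * (Lp + Lm)) hV hV0 hι hρ0 hV3 hfC hgC hfXC hgXC htposC htvelC
    ⟨htail_i, htail⟩ ⟨heex_i, heex_le⟩ hbound hKf0 (hKf a b (Q a b) (hQ0 a b) (hQ1 a b))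
  -- (9) the integrand of the goal
  have hgoalfun : (fun x => ENNReal.ofReal (deriv (fun τ => φ τ x - Q a b τ x) 0 ^ 2
      + deriv (fun y => f y - tpos y) x ^ 2 + V x * (f x - tpos x) ^ 2))
      = fun x => ENNReal.ofReal ((g x - tvel x) ^ 2 + deriv (fun y => f y - tpos y) x ^ 2
        + V x * (f x - tpos x) ^ 2) := by
    funext x
    show _ = ENNReal.ofReal ((deriv (fun τ => φ τ x) 0 - deriv (fun τ => Q a b τ x) 0) ^ 2
      + deriv (fun y => f y - tpos y) x ^ 2 + V x * (f x - tpos x) ^ 2)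
    rw [deriv_fun_sub (hsl φ hφ x) (hsl (Q a b) (hQC a b) x)]
  rw [hgoalfun, ← ofReal_integral_eq_lintegral_ofReal hdata.1
    (ae_of_all _ fun x => by have := hV0 x; positivity)]
  -- (10) bookkeeping
  have hD : ∫ x in Ioi ρ, ((g x - tvel x) ^ 2 + deriv (fun y => f y - tpos y) x ^ 2
      + V x * (f x - tpos x) ^ 2)
      ≤ 3 * θ + 6 * (1 + Kf) * C_A * (Lp + Lm) + 12 * Kf * Cc * Dr / ρ := by
    have h := hdata.2
    have hS0 : 0 ≤ C_A * (Lp + Lm) := by positivity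
    have hKρ : Kf / ρ ≤ Kf := div_le_self hKf0 hρ1
    have h3 : 3 * (Kf / ρ * (2 * (C_A * (Lp + Lm)) + 2 * (2 * Cc * Dr)))
        ≤ 6 * Kf * (C_A * (Lp + Lm)) + 12 * Kf * Cc * Dr / ρ := by
      have e : 3 * (Kf / ρ * (2 * (C_A * (Lp + Lm)) + 2 * (2 * Cc * Dr)))
          = 6 * (Kf / ρ) * (C_A * (Lp + Lm)) + 12 * Kf * Cc * Dr / ρ := by ring
      rw [e]
      nlinarith [mul_le_mul_of_nonneg_right hKρ hS0]
    nlinarith [h, h3]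
  exact farStep_arith hρ0 hθ.le hDr0 hLp0 hLm0 hCA0 hKf0 hCc0 hD hp hm

end Literature.Analysis.PDE
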